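import Literature.Probability.Distributions.CountableTestFamily
import Literature.Probability.Percolation.QuadCrossingSubseqLimits
import Summits.CriticalPhenomena.CardyFormulaZ2.Theorems.CardyMeckeFlipFlipErgodicityZ2StubJointKernelLimitNodeN1abc
import Summits.CriticalPhenomena.CardyFormulaZ2.Theorems.CardyMeckeFlipFlipErgodicityZ2StubJointKernelLimitRealCutoffs

/-!
# Crux `FlipErgodicityZ2` (stmt-CriticalPhenomena-14825), line `registered`: the glue of stub
# `stub_jointKernelLimit` — the registered signature from the graph property N1b

Route `Summits/CriticalPhenomena/CardyFormulaZ2/Theses/CardyMeckeFlip`.  Helper file (supports the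
crux item).  The registered stub `stub_jointKernelLimit` (Garban–Pete–Schramm 2013, Thm. 4.3 and
§4.7, asserted for bond-`ℤ²` in §1 p. 10): from the uniform second moments (B2), every
subsequential quad-crossing limit `μ ∈ Λ` carries a mesh sequence `δ_k → 0⁺` realising it and
measurable, locally integrable kernels `M₀ ε` with the joint convergence
`(ω_{δ_k}, (⟨μ^{εⱼ}_{δ_k}, φⱼ⟩)ⱼ) ⇒ (S, (⟨M₀ εⱼ S, φⱼ⟩)ⱼ)` for ALL finite families of real
cutoffs `εⱼ > 0` and test functions `φⱼ ∈ C_c(ℂ)`.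

This file proves it, sorry-free, **modulo the unprinted core N1b** (every subsequential joint
limit LAW of a configuration with the integrals of countably many test functions against its
averaged pivotal measures is supported on a measurable GRAPH over the limit configuration —
GPS13 Prop. 4.1/4.5, Lemma 4.6, Thm. 4.3, written for site percolation on `𝕋`), taken as the
first hypothesis verbatim:

  `jointKernelLimit_of_graphProperty : N1b → (registered signature of stub_jointKernelLimit)`.

Assembly (`jointKernelLimit_of_graphProperty'`).  Countable dominated-dense test family `𝓓`
(`exists_countable_dominatedDense`).  Pass 1: node N1abc (`jointGraphLimit_on_testFamily`) on the
positive rationals `ℚ₊` gives kernels `M₁` along a subsequence; their a.s. antitonicity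
(`ae_kernel_le_of_graphLimit`) makes the means `q ↦ ∫∫ χ d(M₁ q S) dμ` (`χ ∈ 𝓓`) antitone, and
the discontinuity points of their right regularisations form a countable set `J`.  Pass 2: node
N1abc on `ℚ₊ ∪ J` along the pass-1 subsequence gives kernels `M₂`, again a.s. antitone, hence
with an everywhere-antitone measurable version `M₀` (`exists_antitone_version_of_ae_antitoneOn`),
which is the kernel family of the statement (locally integrable at every `ε > 0` by domination
by `M₂ q`, `q ≤ ε` rational).  The joint convergence at all real cutoffs is node N1e
(`tendsto_jointLaw_realCutoffs`), whose small-gap oracle at `ε₀ ∉ ℚ₊ ∪ J` comes from pass 1: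
continuity at `ε₀` of the regularised mean gives rationals `q' < ε₀ < q` with small pass-1 gap
(`exists_rat_tsub_lt_of_continuousAt`, `integral_min_one_max_le`), and the bounded gap
functional has the SAME limit mean under `M₁` and `M₂` (both are limits of the same lattice
expectations along the final subsequence).
-/

noncomputable section

open MeasureTheory Set Filter Metric Function
open Literature.Probability.Percolation Literature.Probability.Percolation.QuadCrossing
open Literature.Probability.LatticeModels Literature.Probability.Distributions
open scoped ENNReal Topology BoundedContinuousFunction CompactlySupported

namespace Summit.CriticalPhenomena.CardyFormulaZ2.Theorems.CardyMeckeFlip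

/-- **Stub `stub_jointKernelLimit` from the graph property N1b** (named-hypotheses form; see
the module docstring for the two-pass assembly). [folklore] -/
theorem jointKernelLimit_of_graphProperty'
    (hmom : ∀ ε : ℝ, 0 < ε → ∀ φ : ℂ → ℝ, Continuous φ → HasCompactSupport φ →
      ∃ C δ₀ : ℝ, 0 < δ₀ ∧ ∀ δ : ℝ, 0 < δ → δ ≤ δ₀ →
        ∫ ω, (∫ x, |φ x| ∂(z2PivotalMeasure ε δ ω)) ^ 2 ∂(bondPercolation (zdGraph 2) half) ≤ C)
    (hgraph : (∀ ε : ℝ, 0 < ε → ∀ φ : ℂ → ℝ, Continuous φ → HasCompactSupport φ →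
      ∃ C δ₀ : ℝ, 0 < δ₀ ∧ ∀ δ : ℝ, 0 < δ → δ ≤ δ₀ →
        ∫ ω, (∫ x, |φ x| ∂(z2PivotalMeasure ε δ ω)) ^ 2 ∂(bondPercolation (zdGraph 2) half) ≤ C) →
      ∀ (μ : FiniteMeasure (QuadConfig (Set.univ : Set ℂ))) (δs : ℕ → ℝ), (∀ k, 0 < δs k) →
        Tendsto δs atTop (𝓝 0) →
          Tendsto (fun k => z2QuadLaw (Set.univ : Set ℂ) (δs k)) atTop (𝓝 μ) →
            ∀ (ι : Type), Countable ι → ∀ (ε : ι → ℝ), (∀ i, 0 < ε i) → ∀ (φ : ι → ℂ → ℝ),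
              (∀ i, Continuous (φ i)) → (∀ i, HasCompactSupport (φ i)) →
                ∀ (ν : Measure (QuadConfig (Set.univ : Set ℂ) × (ι → ℝ))), IsProbabilityMeasure ν →
                  (∀ G : BoundedContinuousFunction (QuadConfig (Set.univ : Set ℂ) × (ι → ℝ)) ℝ,
                    Tendsto (fun k => ∫ ω, G (z2QuadConfig (Set.univ : Set ℂ) (δs k) ω,
                        fun i => ∫ x, φ i x ∂(z2PivotalMeasure (ε i) (δs k) ω))
                      ∂(bondPercolation (zdGraph 2) half)) atTop (𝓝 (∫ p, G p ∂ν))) →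
                  ∃ T : QuadConfig (Set.univ : Set ℂ) → ι → ℝ, Measurable T ∧
                    ν = (μ : Measure (QuadConfig (Set.univ : Set ℂ))).map (fun S => (S, T S)))
    (μ : FiniteMeasure (QuadConfig (univ : Set ℂ))) (hμ : μ ∈ subseqQuadLimits (univ : Set ℂ)) :
    ∃ (δs : ℕ → ℝ) (M₀ : ℝ → QuadConfig (univ : Set ℂ) → Measure ℂ),
      (∀ k, 0 < δs k) ∧ Tendsto δs atTop (𝓝 0) ∧
        Tendsto (fun k => z2QuadLaw (univ : Set ℂ) (δs k)) atTop (𝓝 μ) ∧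
          (∀ ε : ℝ, Measurable (M₀ ε)) ∧
            (∀ ε : ℝ, 0 < ε → ∀ r : ℝ,
              ∫⁻ S, M₀ ε S (closedBall 0 r) ∂(μ : Measure (QuadConfig (univ : Set ℂ))) < ⊤) ∧
      (∀ (m : ℕ) (εs : Fin m → ℝ) (φ : Fin m → ℂ → ℝ), (∀ j, 0 < εs j) → (∀ j, Continuous (φ j)) →
        (∀ j, HasCompactSupport (φ j)) →
          ∀ F : BoundedContinuousFunction (QuadConfig (univ : Set ℂ) × (Fin m → ℝ)) ℝ,
            Tendsto
              (fun k => ∫ ω, F (z2QuadConfig (univ : Set ℂ) (δs k) ω,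
                  fun j => ∫ x, φ j x ∂(z2PivotalMeasure (εs j) (δs k) ω))
                ∂(bondPercolation (zdGraph 2) half))
              atTop
              (𝓝 (∫ S, F (S, fun j => ∫ x, φ j x ∂(M₀ (εs j) S))
                ∂(μ : Measure (QuadConfig (univ : Set ℂ)))))) := by
  classical
  -- instances: `ℋ` compact metrisable, `μ` and `P_½` probability laws
  haveI : T2Space (QuadConfig (univ : Set ℂ)) :=
    (SchrammSmirnov2011_thm_1_4_holds univ isOpen_univ univ_nonempty).1.2.2
  haveI : TopologicalSpace.MetrizableSpace (QuadConfig (univ : Set ℂ)) :=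
    (SchrammSmirnov2011_thm_1_4_holds univ isOpen_univ univ_nonempty).1.2.1
  haveI : IsProbabilityMeasure (μ : Measure (QuadConfig (univ : Set ℂ))) :=
    isProbabilityMeasure_of_isSubseqQuadLimit isOpen_univ hμ
  haveI : IsProbabilityMeasure (bondPercolation (zdGraph 2) half) := by
    unfold bondPercolation; infer_instance
  obtain ⟨δ, hpos, h0, hlaw⟩ := (isSubseqQuadLimit_iff (univ : Set ℂ) μ).1 hμ
  -- the test family
  obtain ⟨𝓓, h𝓓c, hadd, hsmul, hdense⟩ := exists_countable_dominatedDense ℂ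
  -- pass 1: the positive rationals
  set A₁ : Set ℝ := range (fun q : ℚ => (q : ℝ)) ∩ Ioi 0 with hA₁
  have hA₁c : A₁.Countable := (countable_range _).mono inter_subset_left
  have hA₁pos : ∀ ε ∈ A₁, 0 < ε := fun ε h => h.2
  have hA₁rat : ∀ q : ℚ, 0 < (q : ℝ) → (q : ℝ) ∈ A₁ := fun q hq => ⟨mem_range_self q, hq⟩
  obtain ⟨ψ₁, hψ₁, M₁, hM₁m, hM₁fin, hM₁int, hG₁⟩ := jointGraphLimit_on_testFamily hmom hgraph μ δ
    hpos h0 hlaw h𝓓c hadd hsmul hdense hA₁c hA₁pos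
  have hpos₁ : ∀ k, 0 < δ (ψ₁ k) := fun k => hpos _
  have h0₁ : Tendsto (fun k => δ (ψ₁ k)) atTop (𝓝 0) := h0.comp hψ₁.tendsto_atTop
  have hlaw₁ : Tendsto (fun k => z2QuadLaw (univ : Set ℂ) (δ (ψ₁ k))) atTop (𝓝 μ) :=
    hlaw.comp hψ₁.tendsto_atTop
  have hanti₁ : ∀ ε ∈ A₁, ∀ ε' ∈ A₁, ε' ≤ ε →
      ∀ᵐ S ∂(μ : Measure (QuadConfig (univ : Set ℂ))), M₁ ε S ≤ M₁ ε' S :=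
    fun ε hε ε' hε' hle => ae_kernel_le_of_graphLimit hmom μ hpos₁ h0₁ hdense hA₁pos hM₁m hM₁fin
      hM₁int hG₁ hε hε' hle
  -- the pass-1 means of the cutoffs and the countable jump set
  set L : C_c(ℂ, ℝ) → ℝ → ℝ≥0∞ := fun χ q =>
    ∫⁻ S, ENNReal.ofReal (∫ x, χ x ∂(M₁ q S)) ∂(μ : Measure (QuadConfig (univ : Set ℂ))) with hL
  set J : Set ℝ := ⋃ χ ∈ 𝓓,
    {ε | ¬ ContinuousAt (fun ε : ℝ => ⨆ q : {q : ℚ // ε < q ∧ 0 < (q : ℝ)}, L χ q) ε} with hJ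
  have hJc : J.Countable :=
    h𝓓c.biUnion fun χ _ => (antitone_iSup_rat_gt (L χ)).countable_not_continuousAt
  set A₂ : Set ℝ := A₁ ∪ (J ∩ Ioi 0) with hA₂
  have hA₂c : A₂.Countable := hA₁c.union (hJc.mono inter_subset_left)
  have hA₂pos : ∀ ε ∈ A₂, 0 < ε := by
    rintro ε (h | h)
    exacts [h.2, h.2]
  have hA₁₂ : A₁ ⊆ A₂ := subset_union_left
  -- pass 2: `ℚ₊ ∪ J` along the pass-1 subsequence
  obtain ⟨ψ₂, hψ₂, M₂, hM₂m, hM₂fin, hM₂int, hG₂⟩ := jointGraphLimit_on_testFamily hmom hgraph μ _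
    hpos₁ h0₁ hlaw₁ h𝓓c hadd hsmul hdense hA₂c hA₂pos
  have hpos₂ : ∀ k, 0 < δ (ψ₁ (ψ₂ k)) := fun k => hpos _
  have h0₂ : Tendsto (fun k => δ (ψ₁ (ψ₂ k))) atTop (𝓝 0) := h0₁.comp hψ₂.tendsto_atTop
  have hlaw₂ : Tendsto (fun k => z2QuadLaw (univ : Set ℂ) (δ (ψ₁ (ψ₂ k)))) atTop (𝓝 μ) :=
    hlaw₁.comp hψ₂.tendsto_atTop
  have hanti₂ : ∀ d ∈ A₂, ∀ d' ∈ A₂, d ≤ d' →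
      ∀ᵐ S ∂(μ : Measure (QuadConfig (univ : Set ℂ))), M₂ d' S ≤ M₂ d S :=
    fun d hd d' hd' hle => ae_kernel_le_of_graphLimit hmom μ hpos₂ h0₂ hdense hA₂pos hM₂m hM₂fin
      hM₂int hG₂ hd' hd hle
  -- the everywhere-antitone version
  obtain ⟨M₀, hM₀m, hM₀anti, hM₀dom, hM₀ae⟩ := exists_antitone_version_of_ae_antitoneOn
    (μ : Measure (QuadConfig (univ : Set ℂ))) hA₂c M₂ (fun d _ => hM₂m d) hanti₂
  refine ⟨fun k => δ (ψ₁ (ψ₂ k)), M₀, hpos₂, h0₂, hlaw₂, hM₀m, fun ε hε r => ?_,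
    fun m εs φ hεs hφ hφc F => ?_⟩
  · -- local integrability at every real cutoff: `M₀ ε S ≤ M₂ q S`, `q ≤ ε` rational
    obtain ⟨q, hq0, hqε⟩ := exists_rat_btwn hε
    have hqA : (q : ℝ) ∈ A₂ := hA₁₂ (hA₁rat q hq0)
    exact lt_of_le_of_lt (lintegral_mono fun S => Measure.le_iff'.1 (hM₀dom S ε q hqA hqε.le) _)
      (hM₂int q hqA r)
  -- the joint convergence at all real cutoffs: node N1e with the pass-1 oracle
  refine tendsto_jointLaw_realCutoffs hmom (μ : Measure (QuadConfig (univ : Set ℂ))) hpos₂ h0₂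
    hdense hA₂pos hM₂m hM₂fin hM₂int hG₂ hM₀m hM₀anti hM₀ae ?_ hεs hφ hφc F
  intro ε₀ hε₀ hε₀A χ hχ hχ01 C hC η hη
  -- continuity of the regularised pass-1 mean of `χ` at `ε₀ ∉ J`
  have hcont : ContinuousAt (fun ε : ℝ => ⨆ q : {q : ℚ // ε < q ∧ 0 < (q : ℝ)}, L χ q) ε₀ := by
    by_contra h
    exact hε₀A (Or.inr ⟨mem_iUnion₂.2 ⟨χ, hχ, h⟩, hε₀⟩)
  have hZ : ∀ q : ℚ, 0 < (q : ℝ) →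
      Integrable (fun S => ∫ x, χ x ∂(M₁ q S)) (μ : Measure (QuadConfig (univ : Set ℂ))) :=
    fun q hq => integrable_integral_kernel_of_lintegral_closedBall_lt_top (hM₁m _) (hM₁fin _)
      (hM₁int _ (hA₁rat q hq)) χ hχ01
  have hmq0 : ∀ q : ℝ, 0 ≤ ∫ S, ∫ x, χ x ∂(M₁ q S) ∂(μ : Measure (QuadConfig (univ : Set ℂ))) :=
    fun q => integral_nonneg fun S => integral_nonneg fun x => (hχ01 x).1
  have hLeq : ∀ q : ℚ, 0 < (q : ℝ) → L χ q =
      ENNReal.ofReal (∫ S, ∫ x, χ x ∂(M₁ q S) ∂(μ : Measure (QuadConfig (univ : Set ℂ)))) :=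
    fun q hq => (ofReal_integral_eq_lintegral_ofReal (hZ q hq)
      (ae_of_all _ fun S => integral_nonneg fun x => (hχ01 x).1)).symm
  have hLanti : ∀ q q' : ℚ, 0 < (q' : ℝ) → q' ≤ q → L χ q ≤ L χ q' := fun q q' hq' hle => by
    have hle' : (q' : ℝ) ≤ q := by exact_mod_cast hle
    have hq : 0 < (q : ℝ) := hq'.trans_le hle'
    refine lintegral_mono_ae ((hanti₁ q (hA₁rat q hq) q' (hA₁rat q' hq') hle').mono
      fun S hS => ENNReal.ofReal_le_ofReal ?_)
    haveI := hM₁fin (q' : ℝ) S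
    exact integral_mono_measure hS (ae_of_all _ fun x => (hχ01 x).1) χ.integrable
  have hLfin : ∀ q : ℚ, 0 < (q : ℝ) → L χ q ≠ ⊤ := fun q hq => by
    rw [hLeq q hq]
    exact ENNReal.ofReal_ne_top
  -- rationals `q' < ε₀ < q` with small pass-1 gap
  obtain ⟨q, q', hq'0, hq'ε, hεq, hgap⟩ := exists_rat_tsub_lt_of_continuousAt hLanti hLfin hε₀ hcont
    (ENNReal.ofReal_pos.2 (by positivity : 0 < η / (C + 1)))
  have hq0 : 0 < (q : ℝ) := hε₀.trans hεq
  have hreal : ∫ S, ∫ x, χ x ∂(M₁ q' S) ∂(μ : Measure (QuadConfig (univ : Set ℂ))) -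
      ∫ S, ∫ x, χ x ∂(M₁ q S) ∂(μ : Measure (QuadConfig (univ : Set ℂ))) < η / (C + 1) := by
    rw [hLeq q hq0, hLeq q' hq'0, ← ENNReal.ofReal_sub _ (hmq0 q),
      ENNReal.ofReal_lt_ofReal_iff (by positivity)] at hgap
    exact hgap
  -- the bounded gap functional: small limit mean under `M₁` ...
  obtain ⟨G, hGf⟩ := exists_bcf_gap (E := QuadConfig (univ : Set ℂ)) (ι := A₁ × 𝓓) C
    ((⟨q', hA₁rat q' hq'0⟩ : A₁), (⟨χ, hχ⟩ : 𝓓)) ((⟨q, hA₁rat q hq0⟩ : A₁), (⟨χ, hχ⟩ : 𝓓))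
  obtain ⟨G₂, hG₂f⟩ := exists_bcf_gap (E := QuadConfig (univ : Set ℂ)) (ι := A₂ × 𝓓) C
    ((⟨q', hA₁₂ (hA₁rat q' hq'0)⟩ : A₂), (⟨χ, hχ⟩ : 𝓓))
    ((⟨q, hA₁₂ (hA₁rat q hq0)⟩ : A₂), (⟨χ, hχ⟩ : 𝓓))
  have hΓ₁ : ∫ S, G (S, fun p => ∫ x, (p.2 : C_c(ℂ, ℝ)) x ∂(M₁ (p.1 : ℝ) S))
      ∂(μ : Measure (QuadConfig (univ : Set ℂ))) < η := by
    simp only [hGf]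
    have hle : ∀ᵐ S ∂(μ : Measure (QuadConfig (univ : Set ℂ))),
        ∫ x, χ x ∂(M₁ q S) ≤ ∫ x, χ x ∂(M₁ q' S) := by
      filter_upwards [hanti₁ q (hA₁rat q hq0) q' (hA₁rat q' hq'0) (hq'ε.trans hεq).le] with S hS
      haveI := hM₁fin (q' : ℝ) S
      exact integral_mono_measure hS (ae_of_all _ fun x => (hχ01 x).1) χ.integrable
    refine lt_of_le_of_lt (integral_min_one_max_le (hZ q' hq'0) (hZ q hq0) hle hC) ?_
    calc C * (∫ S, ∫ x, χ x ∂(M₁ q' S) ∂(μ : Measure (QuadConfig (univ : Set ℂ))) -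
          ∫ S, ∫ x, χ x ∂(M₁ q S) ∂(μ : Measure (QuadConfig (univ : Set ℂ))))
        ≤ C * (η / (C + 1)) := mul_le_mul_of_nonneg_left hreal.le hC
      _ = η * (C / (C + 1)) := by ring
      _ < η := mul_lt_of_lt_one_right hη ((div_lt_one (by positivity)).2 (by linarith))
  -- ... and the same limit mean under `M₂` (limits of the same lattice expectations)
  have hΓeq : ∫ S, G₂ (S, fun p => ∫ x, (p.2 : C_c(ℂ, ℝ)) x ∂(M₂ (p.1 : ℝ) S))
      ∂(μ : Measure (QuadConfig (univ : Set ℂ))) =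
      ∫ S, G (S, fun p => ∫ x, (p.2 : C_c(ℂ, ℝ)) x ∂(M₁ (p.1 : ℝ) S))
      ∂(μ : Measure (QuadConfig (univ : Set ℂ))) := by
    refine tendsto_nhds_unique (hG₂ G₂) (((hG₁ G).comp hψ₂.tendsto_atTop).congr fun k => ?_)
    simp only [Function.comp_apply, hGf, hG₂f]
  refine ⟨q, hA₁₂ (hA₁rat q hq0), q', hA₁₂ (hA₁rat q' hq'0), hq'ε, hεq, ?_⟩
  have e : ∫ S, min 1 (max 0 (C * (∫ x, χ x ∂(M₂ q' S) - ∫ x, χ x ∂(M₂ q S))))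
      ∂(μ : Measure (QuadConfig (univ : Set ℂ))) =
      ∫ S, G₂ (S, fun p => ∫ x, (p.2 : C_c(ℂ, ℝ)) x ∂(M₂ (p.1 : ℝ) S))
      ∂(μ : Measure (QuadConfig (univ : Set ℂ))) := by
    simp only [hG₂f]
  rw [e, hΓeq]
  exact hΓ₁


/-- **Stub `stub_jointKernelLimit` of the birth skeleton of crux `FlipErgodicityZ2` from the
graph property N1b: the registered signature, VERBATIM, as the conclusion.**  First hypothesis:
node N1b (UNPRINTED for bond-`ℤ²`; Garban–Pete–Schramm 2013 Prop. 4.1/4.5, Lemma 4.6, Thm. 4.3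
for site-`𝕋`): given the uniform second moments, every subsequential joint limit law of a
configuration with the integrals of countably many test functions against its averaged pivotal
measures, along a mesh sequence realising `μ`, is the push-forward of `μ` along a measurable
graph.  Conclusion: the registered stub (uniform second moments ⇒ for every `μ ∈ Λ` a mesh
sequence realising `μ` and measurable, locally integrable kernels `M₀ ε` with the joint
convergence at all finite families of real cutoffs and test functions).  See
`jointKernelLimit_of_graphProperty'` and the module docstring for the assembly. [folklore] -/
theorem jointKernelLimit_of_graphProperty :
    ((∀ ε : ℝ, 0 < ε → ∀ φ : ℂ → ℝ, Continuous φ → HasCompactSupport φ → ∃ C δ₀ : ℝ, 0 < δ₀ ∧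
      ∀ δ : ℝ, 0 < δ → δ ≤ δ₀ → ∫ ω, (∫ x,
      |φ x| ∂(z2PivotalMeasure ε δ ω)) ^ 2 ∂(bondPercolation (zdGraph 2) half) ≤ C) →
      ∀ (μ : FiniteMeasure (QuadConfig (Set.univ : Set ℂ))) (δs : ℕ → ℝ), (∀ k, 0 < δs k) →
      Tendsto δs atTop (𝓝 0) → Tendsto (fun k => z2QuadLaw (Set.univ : Set ℂ) (δs k)) atTop (𝓝 μ)
      → ∀ (ι : Type), Countable ι → ∀ (ε : ι → ℝ), (∀ i, 0 < ε i) → ∀ (φ : ι → ℂ → ℝ), (∀ i,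
      Continuous (φ i)) → (∀ i, HasCompactSupport (φ i)) →
      ∀ (ν : Measure (QuadConfig (Set.univ : Set ℂ) × (ι → ℝ))), IsProbabilityMeasure ν →
      (∀ G : BoundedContinuousFunction (QuadConfig (Set.univ : Set ℂ) × (ι → ℝ)) ℝ,
      Tendsto (fun k => ∫ ω, G (z2QuadConfig (Set.univ : Set ℂ) (δs k) ω, fun i => ∫ x,
      φ i x ∂(z2PivotalMeasure (ε i) (δs k) ω)) ∂(bondPercolation (zdGraph 2) half)) atTop (𝓝 (∫
      p, G p ∂ν))) → ∃ T : QuadConfig (Set.univ : Set ℂ) → ι → ℝ, Measurable T ∧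
      ν = (μ : Measure (QuadConfig (Set.univ : Set ℂ))).map (fun S => (S, T S))) → (∀ ε : ℝ,
      0 < ε → ∀ φ : ℂ → ℝ, Continuous φ → HasCompactSupport φ → ∃ C δ₀ : ℝ, 0 < δ₀ ∧ ∀ δ : ℝ,
      0 < δ → δ ≤ δ₀ → ∫ ω, (∫ x, |φ x| ∂(z2PivotalMeasure ε δ ω)) ^ 2 ∂(bondPercolation (zdGraph
      2) half) ≤ C) → ∀ μ : FiniteMeasure (QuadConfig (Set.univ : Set ℂ)),
      μ ∈ subseqQuadLimits (Set.univ : Set ℂ) → ∃ (δs : ℕ → ℝ) (M₀ : ℝ →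
      QuadConfig (Set.univ : Set ℂ) → Measure ℂ), (∀ k, 0 < δs k) ∧ Tendsto δs atTop (𝓝 0) ∧
      Tendsto (fun k => z2QuadLaw (Set.univ : Set ℂ) (δs k)) atTop (𝓝 μ) ∧ (∀ ε : ℝ,
      Measurable (M₀ ε)) ∧ (∀ ε : ℝ, 0 < ε → ∀ r : ℝ, ∫⁻ S,
      M₀ ε S (closedBall 0 r) ∂(μ : Measure (QuadConfig (Set.univ : Set ℂ))) < ⊤) ∧
      (∀ (m : ℕ) (εs : Fin m → ℝ) (φ : Fin m → ℂ → ℝ), (∀ j, 0 < εs j) → (∀ j, Continuous (φ j)) →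
      (∀ j, HasCompactSupport (φ j)) → ∀ F : BoundedContinuousFunction (QuadConfig (Set.univ : Set
      ℂ) × (Fin m → ℝ)) ℝ, Tendsto (fun k => ∫ ω, F (z2QuadConfig (Set.univ : Set ℂ) (δs k) ω,
      fun j => ∫ x, φ j x ∂(z2PivotalMeasure (εs j) (δs k) ω)) ∂(bondPercolation (zdGraph 2)
      half)) atTop (𝓝 (∫ S, F (S, fun j => ∫ x,
      φ j x ∂(M₀ (εs j) S)) ∂(μ : Measure (QuadConfig (Set.univ : Set ℂ)))))) := by
  intro hgraph hmom μ hμ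
  exact jointKernelLimit_of_graphProperty' hmom hgraph μ hμ

end Summit.CriticalPhenomena.CardyFormulaZ2.Theorems.CardyMeckeFlip

end
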